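import Summits.Schanuel.Schanuel.Theorems.RootDecomp1KB3KirbyTrace01

/-!
# RootDecomp1KB3KirbyTrace — lens 6, generation 25, node 2 «THE LIOUVILLE SIDE OF 1K LIVES ON KIRBY'S COUNTABLE CORE» (CLAIM L2330, PRICE + CHECKLIST G30-α L2334, NODE L2341, critic VERDICT L2344: CLEARED THEOREM ×1 = CONDITIONAL CORE-COLLAPSE CERTIFICATE, moves no item, rung 0; PORT GO L2346) — continuation (RootDecomp1KB3KirbyTrace02): §4 the pointwise Kirby trace, §5 the items restricted to E and exactness of the residual

(lens-6 g25b HOME kernel K2 = HOME/decomp-schanuel-lens-6/g25/B3KirbyTrace.lean 507fd15c…, 722 l, imports Theses RootDecomp1K / DiophantineCore / EclCore + Theorems RootDecomp1KHyper16 / RootDecomp1KGeneric02 / RootDecomp1EssentialInEclCore + six Literature Kirby/ecl/Diaz modules; P2/C2 + NODE-g25b.md 734c3ad1…. Port by census-1 gen 20 as `RootDecomp1KB3KirbyTrace01–03`: 01 = §1 the countable core `E = ecl ∅` (`span_le_E`), §2 measures vs the route's cut predicates (`measure_pow_of_poly`, `not_linLiouville_of_measure`, `not_hyperLinLiouville_of_measure`,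 `not_liouville_of_pair_measure`), §3 the crux 3817 on the core (`khovanskii_witness`, `measure_of_bakerOnE`, `not_linLiouville_of_bakerOnE`, `not_hyperLinLiouville_of_bakerOnE`, `not_liouville_coord_of_bakerOnE`, `not_coordLiouvilleSpan_of_bakerOnE`, price tag `not_liouville_exp_exp_one_of_bakerOnExpAlgebraic`); 02 = §4 the pointwise Kirby trace (`sb_of_eclTrace`, KNOWN Kirby 2010 Prop 7.2 / KNOWN-IN-TREE item 24395 `essentialCounterexamplesInEcl_core` BY NAME) + §5 the four items restricted to `E` (`…OnE`), `schanuel_of_piecesOnE`, heredity (`linLiouville_of_lattice`, `linLiouville_of_spanQ`, `polyMeasure_hered`, `coordClause_hered`) and the ONE iff `polyDiophantineSchanuelOnE_iff : B₃ᴱ ↔ B₃`; 03 = §6 (†) `schanuel_of_bakerOnExpAlgebraic_of_polyDiophantineSchanuel : BakerOnExpAlgebraic → PolyDiophantineSchanuel → Schanuel`, `aPiecesOnE_of_bakerOnExpAlgebraic`, §7 (†′) `schanuel_of_thOnExpAlgebraic_of_piecesOnE`, `bakerOnExpAlgebraicImpTH_holds : BakerOnExpAlgebraicImpTH` (item stmt-Schanuel-3818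 of route DiophantineCore, PROVED), §8 T5 `polyDiophantineSchanuel_of_schanuelUnderTH : SchanuelUnderTH → PolyDiophantineSchanuel`.
PORT EDITS (census g20): the §1 membership one-liners (`zero/one/add/sub/mul/div/exp/ratCast/natCast/two_mem_E`, `I_mem_E`, `conj_mem_E`, `re_mem_E`, `im_mem_E`, `exp_exp_one_mem_E`, `mem_eclSubfield_iff`), `linearIndependent_one_of_irrational` and the read-back `schanuel_iff_eclcoreThesis` are `private` (dedup-safety: tree twins `AclSubsetLogFreeCore/Negative/CoreAut*` `sub_mem_ecl_empty` / `I_mem_ecl_empty` / `conj_mem_ecl_empty` / `ofReal_re_mem_ecl_empty` / `ofReal_im_mem_ecl_empty` / `ratCast_mem_ecl_empty` / `cexp_mem_ecl_empty`, `RootDecomp1PillayTupleExpE.expE_mem_ecl`, `RootDecomp1BRadicalDescent.linearIndependent_one_of_irrational`); K's two auxiliary data definitions `conjExpHom` (+ `conjExpHom_apply`) and `eclSubmoduleQ` are INLINED into the proofs of `conj_mem_E` / `span_le_E` (no `def` outside §5); the unused `intCast_mem_E` is dropped; the four `…OnE` restricted-item definitions carry the «[restriction] definition» docstring tag; all other statements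 and proofs verbatim. Parts 01/02 `--supports stmt-Schanuel-31987` (the residual), part 03 `--workitem stmt-Schanuel-3818` (it proves that support item of route DiophantineCore by name) if the gate accepts, else `--supports`; no census credit carried; rung 0 — nothing here proves Schanuel.)
-/

noncomputable section

open Complex IntermediateField Finset
open scoped BigOperators

namespace Summit.Schanuel.Schanuel.Theorems.RootDecomp1KB3KirbyTrace

open Literature.NumberTheory.Transcendental
open Literature.ModelTheory.ExponentialFields (ExponentialRing ExponentialRingHom)
open Summit.Schanuel.Schanuel.Theses.RootDecomp1K (PolyDiophantineSchanuel CoordLiouvilleSchanuel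
  HyperLiouvilleSchanuel FiniteOrderLiouvilleSchanuel LinLiouvilleSchanuel StrictDiophantineSchanuel)
open Summit.Schanuel.Schanuel.Theses.DiophantineCore (BakerOnExpAlgebraic THOnExpAlgebraic SchanuelUnderTH
  BakerOnExpAlgebraicImpTH)
open Summit.Schanuel.Schanuel.Theses.EclCore (EclcoreThesis)
open Summit.Schanuel.Schanuel.Theorems.RootDecomp1EssentialInEclCore (essentialCounterexamplesInEcl_core)
open Summit.Schanuel.Schanuel.Theorems.RootDecomp1KGeneric (not_technicalHypothesis_of_hyperLinLiouville)
open Summit.Schanuel.Schanuel.Theorems.RootDecomp1KHyper (LinLiouville CoordLiouvilleSpan one_le_hsum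
  hsum_nonneg exists_half_pow_le exists_le_two_pow linLiouville_of_liouville_ratio)
open Summit.Schanuel.Schanuel.Theorems.RootDecomp1KHyper.HyperCell (HyperLinLiouville)

/-! ### §4  The pointwise Kirby trace (KNOWN: Kirby 2010 Prop. 7.2; KNOWN-IN-TREE: item 24395) -/

/-- **Pointwise Kirby trace** — a corollary, by strong induction on `n`, of the tree-proved item
`essentialCounterexamplesInEcl_core` (stmt-Schanuel-24395, route RootDecomp1: a span-minimal
counterexample to Schanuel lies in `E`; Kirby 2010 Prop. 7.2): Schanuel's inequality at a `ℚ`-free `x̄`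
follows from the inequality at every `ℚ`-free `E`-tuple INSIDE `span_ℚ(x̄)`.  KNOWN (print) and
KNOWN-IN-TREE; recorded here only because the heredity theorem of §5 needs the span clause. -/
theorem sb_of_eclTrace : ∀ (n : ℕ) (x : Fin n → ℂ), LinearIndependent ℚ x →
    (∀ (k : ℕ) (y : Fin k → ℂ), (∀ i, y i ∈ ecl (∅ : Set ℂ)) →
      (∀ i, y i ∈ Submodule.span ℚ (Set.range x)) → LinearIndependent ℚ y →
      (k : Cardinal) ≤ Algebra.trdeg ℚ ↥(adjoin ℚ (Set.range y ∪ Set.range (Complex.exp ∘ y)))) →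
    (n : Cardinal) ≤ Algebra.trdeg ℚ ↥(adjoin ℚ (Set.range x ∪ Set.range (Complex.exp ∘ x))) := by
  intro n
  induction n using Nat.strong_induction_on with
  | _ n ih =>
    intro x hx H
    by_contra hlt
    rw [not_le] at hlt
    have hmin : ∀ m : ℕ, m < n → ∀ w : Fin m → ℂ, LinearIndependent ℚ w →
        (∀ i, w i ∈ Submodule.span ℚ (Set.range x)) →
        (m : Cardinal) ≤ Algebra.trdeg ℚ ↥(adjoin ℚ (Set.range w ∪ Set.range (Complex.exp ∘ w))) := by
      intro m hm w hw hwx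
      refine ih m hm w hw fun k y hyE hyw hyli => H k y hyE (fun i => ?_) hyli
      exact (Submodule.span_le.mpr (Set.range_subset_iff.mpr hwx)) (hyw i)
    have hxE : ∀ i, x i ∈ ecl (∅ : Set ℂ) := essentialCounterexamplesInEcl_core n x hx hmin hlt
    exact absurd (H n x hxE (fun i => Submodule.subset_span ⟨i, rfl⟩) hx) (not_le.mpr hlt)

/-- The trace with the span clause forgotten (= Kirby's Prop. 7.2 pointwise). -/
theorem sb_of_eclTrace' {n : ℕ} {x : Fin n → ℂ} (hx : LinearIndependent ℚ x)
    (H : ∀ (k : ℕ) (y : Fin k → ℂ), (∀ i, y i ∈ ecl (∅ : Set ℂ)) → LinearIndependent ℚ y →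
      (k : Cardinal) ≤ Algebra.trdeg ℚ ↥(adjoin ℚ (Set.range y ∪ Set.range (Complex.exp ∘ y)))) :
    (n : Cardinal) ≤ Algebra.trdeg ℚ ↥(adjoin ℚ (Set.range x ∪ Set.range (Complex.exp ∘ x))) :=
  sb_of_eclTrace n x hx fun k y hyE _ hyli => H k y hyE hyli

/-- `Schanuel ↔ EclcoreThesis` (the closed route EclCore's item stmt-Schanuel-0066) IS the tree's
`schanuelConjecture_iff_ecl_empty_holds`, by `rfl` on both sides. -/
private theorem schanuel_iff_eclcoreThesis : _root_.Schanuel ↔ EclcoreThesis :=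
  schanuelConjecture_iff_ecl_empty_holds

/-! ### §5  The four items restricted to the core, and exactness of the residual's restriction -/

/-- [restriction] definition — NOT a fact and NOT a new obligation (census convention): the LIVE item
`CoordLiouvilleSchanuel` (stmt-Schanuel-31077) with ONE extra binder `∀ i, z i ∈ ecl ∅` (restriction to `E`-tuples). -/
def CoordLiouvilleSchanuelOnE : Prop :=
  ∀ (n : ℕ) (z : Fin n → ℂ), LinearIndependent ℚ z → (∀ i, z i ∈ ecl (∅ : Set ℂ)) →
    (∃ w ∈ Submodule.span ℚ (Set.range z), Liouville w.re ∨ Liouville w.im) →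
    (n : Cardinal) ≤ Algebra.trdeg ℚ ↥(IntermediateField.adjoin ℚ (Set.range z ∪ Set.range (Complex.exp ∘ z)))

/-- [restriction] definition — NOT a fact and NOT a new obligation (census convention): the LIVE item
`HyperLiouvilleSchanuel` (stmt-Schanuel-33363) with ONE extra binder `∀ i, z i ∈ ecl ∅` (restriction to `E`-tuples). -/
def HyperLiouvilleSchanuelOnE : Prop :=
  ∀ (n : ℕ) (z : Fin n → ℂ), LinearIndependent ℚ z → (∀ i, z i ∈ ecl (∅ : Set ℂ)) →
    (∀ m : ℕ, ∃ h : Fin n → ℤ, h ≠ 0 ∧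
      ‖∑ i, (h i : ℂ) * z i‖ < Real.exp (-((1 + ∑ i, (|h i| : ℝ)) ^ m))) →
    (n : Cardinal) ≤ Algebra.trdeg ℚ ↥(IntermediateField.adjoin ℚ (Set.range z ∪ Set.range (Complex.exp ∘ z)))

/-- [restriction] definition — NOT a fact and NOT a new obligation (census convention): the LIVE item
`FiniteOrderLiouvilleSchanuel` (stmt-Schanuel-33364) with ONE extra binder `∀ i, z i ∈ ecl ∅` (restriction to `E`-tuples). -/
def FiniteOrderLiouvilleSchanuelOnE : Prop :=
  ∀ (n : ℕ) (z : Fin n → ℂ), LinearIndependent ℚ z → (∀ i, z i ∈ ecl (∅ : Set ℂ)) →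
    (∀ ω : ℕ, ∃ h : Fin n → ℤ, h ≠ 0 ∧ ‖∑ i, (h i : ℂ) * z i‖ < 1 / (1 + ∑ i, (|h i| : ℝ)) ^ ω) →
    (¬ ∀ m : ℕ, ∃ h : Fin n → ℤ, h ≠ 0 ∧
      ‖∑ i, (h i : ℂ) * z i‖ < Real.exp (-((1 + ∑ i, (|h i| : ℝ)) ^ m))) →
    (n : Cardinal) ≤ Algebra.trdeg ℚ ↥(IntermediateField.adjoin ℚ (Set.range z ∪ Set.range (Complex.exp ∘ z)))

/-- [restriction] definition — NOT a fact and NOT a new obligation (census convention): the route's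
RESIDUAL `PolyDiophantineSchanuel` (stmt-Schanuel-31987) with ONE extra binder `∀ i, z i ∈ ecl ∅` (restriction to `E`-tuples). -/
def PolyDiophantineSchanuelOnE : Prop :=
  ∀ (n : ℕ) (z : Fin n → ℂ), LinearIndependent ℚ z → (∀ i, z i ∈ ecl (∅ : Set ℂ)) →
    (¬ ∃ w ∈ Submodule.span ℚ (Set.range z), Liouville w.re ∨ Liouville w.im) →
    (¬ ∀ ω : ℕ, ∃ h : Fin n → ℤ, h ≠ 0 ∧ ‖∑ i, (h i : ℂ) * z i‖ < 1 / (1 + ∑ i, (|h i| : ℝ)) ^ ω) →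
    (n : Cardinal) ≤ Algebra.trdeg ℚ ↥(IntermediateField.adjoin ℚ (Set.range z ∪ Set.range (Complex.exp ∘ z)))

/-- `A₁ → A₁ᴱ` (restriction). -/
theorem coordLiouvilleSchanuelOnE_of (h : CoordLiouvilleSchanuel) : CoordLiouvilleSchanuelOnE :=
  fun n z hz _ hL => h n z hz hL

/-- `A₂ʰ → A₂ʰᴱ` (restriction). -/
theorem hyperLiouvilleSchanuelOnE_of (h : HyperLiouvilleSchanuel) : HyperLiouvilleSchanuelOnE :=
  fun n z hz _ hH => h n z hz hH

/-- `A₂ᵈ → A₂ᵈᴱ` (restriction). -/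
theorem finiteOrderLiouvilleSchanuelOnE_of (h : FiniteOrderLiouvilleSchanuel) :
    FiniteOrderLiouvilleSchanuelOnE :=
  fun n z hz _ hLF hH => h n z hz hLF hH

/-- `B₃ → B₃ᴱ` (restriction). -/
theorem polyDiophantineSchanuelOnE_of (h : PolyDiophantineSchanuel) : PolyDiophantineSchanuelOnE :=
  fun n z hz _ hD hL => h n z hz hD hL

/-- The restricted items give `EclcoreThesis` (S on the core): the case split of the route's `closes`,
verbatim, at `E`-tuples. -/
theorem eclcoreThesis_of_piecesOnE (hL : CoordLiouvilleSchanuelOnE) (hH : HyperLiouvilleSchanuelOnE)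
    (hF : FiniteOrderLiouvilleSchanuelOnE) (hB : PolyDiophantineSchanuelOnE) : EclcoreThesis := by
  intro n z hzE hz
  by_cases h : ∃ w ∈ Submodule.span ℚ (Set.range z), Liouville w.re ∨ Liouville w.im
  · exact hL n z hz hzE h
  · by_cases hLF : ∀ ω : ℕ, ∃ h : Fin n → ℤ, h ≠ 0 ∧
        ‖∑ i, (h i : ℂ) * z i‖ < 1 / (1 + ∑ i, (|h i| : ℝ)) ^ ω
    · by_cases hyp : ∀ m : ℕ, ∃ h : Fin n → ℤ, h ≠ 0 ∧
          ‖∑ i, (h i : ℂ) * z i‖ < Real.exp (-((1 + ∑ i, (|h i| : ℝ)) ^ m))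
      · exact hH n z hz hzE hyp
      · exact hF n z hz hzE hLF hyp
    · exact hB n z hz hzE h hLF

/-- **The restricted items still decide the summit** (summit decl BY NAME): `EclcoreThesis` through the
tree's `schanuelConjecture_iff_ecl_empty_holds.mpr`, exactly as `DiophantineCore.closes` uses it. -/
theorem schanuel_of_piecesOnE (hL : CoordLiouvilleSchanuelOnE) (hH : HyperLiouvilleSchanuelOnE)
    (hF : FiniteOrderLiouvilleSchanuelOnE) (hB : PolyDiophantineSchanuelOnE) : _root_.Schanuel :=
  schanuelConjecture_iff_ecl_empty_holds.mpr (eclcoreThesis_of_piecesOnE hL hH hF hB)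

/-- Sub-lattice tuples have smaller `ℚ`-span. -/
theorem span_le_of_lattice {n k : ℕ} {x : Fin n → ℂ} {y : Fin k → ℂ}
    (hyx : ∀ i, y i ∈ Submodule.span ℤ (Set.range x)) :
    Submodule.span ℚ (Set.range y) ≤ Submodule.span ℚ (Set.range x) :=
  Submodule.span_le.mpr (Set.range_subset_iff.mpr fun i =>
    Submodule.span_le_restrictScalars ℤ ℚ (Set.range x) (hyx i))

/-- `CoordLiouvilleSpan` ascends from sub-lattice tuples. -/
theorem coordLiouvilleSpan_of_lattice {n k : ℕ} {x : Fin n → ℂ} {y : Fin k → ℂ}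
    (hyx : ∀ i, y i ∈ Submodule.span ℤ (Set.range x)) (h : CoordLiouvilleSpan y) :
    CoordLiouvilleSpan x := by
  obtain ⟨w, hw, hL⟩ := h
  exact ⟨w, span_le_of_lattice hyx hw, hL⟩

/-- **`LinLiouville` ascends from `ℚ`-free sub-lattice tuples**: an integer form `g` in `ȳ = M x̄` is
the integer form `gM` in `x̄`, non-zero by `ℚ`-freeness of `ȳ`, of height `≤ (1 + Σ|Mᵢⱼ|)·Σ|gᵢ|`; the
polynomial loss in the height is absorbed by raising the order. -/
theorem linLiouville_of_lattice {n k : ℕ} {x : Fin n → ℂ} {y : Fin k → ℂ}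
    (hyx : ∀ i, y i ∈ Submodule.span ℤ (Set.range x)) (hy : LinearIndependent ℚ y)
    (hL : LinLiouville y) : LinLiouville x := by
  classical
  choose M hM using fun i => (Submodule.mem_span_range_iff_exists_fun ℤ).mp (hyx i)
  -- hM i : ∑ j, M i j • x j = y i
  have hMy : ∀ i, y i = ∑ j, (M i j : ℂ) * x j := by
    intro i; rw [← hM i]; simp [zsmul_eq_mul]
  set C : ℝ := 1 + ∑ i, ∑ j, (|M i j| : ℝ) with hC
  have hC1 : 1 ≤ C := by
    have : 0 ≤ ∑ i, ∑ j, (|M i j| : ℝ) := sum_nonneg fun i _ => sum_nonneg fun j _ => by positivity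
    linarith
  obtain ⟨d, hd⟩ := exists_le_two_pow C
  intro ω
  obtain ⟨g, hg, hlt⟩ := hL ((d + 1) * ω)
  -- the form `h = g M` in `x̄`
  let h : Fin n → ℤ := fun j => ∑ i, g i * M i j
  have hform : ∑ j, (h j : ℂ) * x j = ∑ i, (g i : ℂ) * y i := by
    simp only [h, hMy, Int.cast_sum, Int.cast_mul, sum_mul, mul_sum]
    rw [sum_comm]
    refine sum_congr rfl fun i _ => sum_congr rfl fun j _ => ?_
    ring
  have hh : h ≠ 0 := by
    intro h0
    have hrel : ∑ i, (g i : ℂ) * y i = 0 := by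
      rw [← hform]
      simp [h0]  -- h = 0 pointwise
    have hgq : ∀ i, (g i : ℚ) = 0 := by
      have := Fintype.linearIndependent_iff.mp hy (fun i => (g i : ℚ)) (by
        simpa [Rat.smul_def] using hrel)
      exact this
    exact hg (funext fun i => by exact_mod_cast hgq i)
  -- heights
  have hG1 : 1 ≤ ∑ i, (|g i| : ℝ) := one_le_hsum hg
  have hT : ∑ j, (|h j| : ℝ) ≤ (C - 1) * ∑ i, (|g i| : ℝ) := by
    have h1 : ∀ j, (|h j| : ℝ) ≤ ∑ i, (|g i| : ℝ) * |(M i j : ℝ)| := by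
      intro j
      have : (|h j| : ℝ) = |∑ i, (g i : ℝ) * (M i j : ℝ)| := by
        simp [h, Int.cast_sum, Int.cast_mul]
      rw [this]
      refine (abs_sum_le_sum_abs _ _).trans (le_of_eq ?_)
      refine sum_congr rfl fun i _ => ?_
      rw [abs_mul]
    calc ∑ j, (|h j| : ℝ) ≤ ∑ j, ∑ i, (|g i| : ℝ) * |(M i j : ℝ)| := sum_le_sum fun j _ => h1 j
      _ = ∑ i, (|g i| : ℝ) * ∑ j, |(M i j : ℝ)| := by
          rw [sum_comm]; exact sum_congr rfl fun i _ => (mul_sum _ _ _).symm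
      _ ≤ ∑ i, (|g i| : ℝ) * ∑ i', ∑ j, (|M i' j| : ℝ) := by
          refine sum_le_sum fun i _ => mul_le_mul_of_nonneg_left ?_ (by positivity)
          exact single_le_sum (f := fun i' => ∑ j, (|M i' j| : ℝ))
            (fun i' _ => sum_nonneg fun j _ => by positivity) (mem_univ i)
      _ = (C - 1) * ∑ i, (|g i| : ℝ) := by rw [← sum_mul, hC]; ring
  -- `1 + T ≤ (1 + G)^(d+1)`
  have hbase : 1 + ∑ j, (|h j| : ℝ) ≤ (1 + ∑ i, (|g i| : ℝ)) ^ (d + 1) := by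
    have hG2 : (2 : ℝ) ≤ 1 + ∑ i, (|g i| : ℝ) := by linarith
    have hCd : C ≤ (1 + ∑ i, (|g i| : ℝ)) ^ d :=
      hd.trans (pow_le_pow_left₀ (by norm_num) hG2 d)
    calc 1 + ∑ j, (|h j| : ℝ) ≤ 1 + (C - 1) * ∑ i, (|g i| : ℝ) := by linarith
      _ ≤ C * (1 + ∑ i, (|g i| : ℝ)) := by nlinarith
      _ ≤ (1 + ∑ i, (|g i| : ℝ)) ^ d * (1 + ∑ i, (|g i| : ℝ)) :=
          mul_le_mul_of_nonneg_right hCd (by positivity)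
      _ = (1 + ∑ i, (|g i| : ℝ)) ^ (d + 1) := by rw [pow_succ]
  refine ⟨h, hh, ?_⟩
  rw [hform]
  refine hlt.trans_le ?_
  -- 1/(1+G)^((d+1)ω) ≤ 1/(1+T)^ω
  rw [pow_mul]
  exact one_div_le_one_div_of_le (by positivity) (pow_le_pow_left₀ (by positivity) hbase ω)

/-- `LinLiouville` is stable under a common integer rescaling `ȳ ↦ N·ȳ` (`N` absorbed by raising the
order by `d`, `2^d ≥ N`). -/
theorem linLiouville_smul {k : ℕ} {y : Fin k → ℂ} (N : ℕ) (hN : N ≠ 0) (hL : LinLiouville y) :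
    LinLiouville (fun i => (N : ℂ) * y i) := by
  obtain ⟨d, hd⟩ := exists_le_two_pow (N : ℝ)
  intro ω
  obtain ⟨g, hg, hlt⟩ := hL (ω + d)
  refine ⟨g, hg, ?_⟩
  have hform : ∑ i, (g i : ℂ) * ((N : ℂ) * y i) = (N : ℂ) * ∑ i, (g i : ℂ) * y i := by
    rw [mul_sum]; exact sum_congr rfl fun i _ => by ring
  rw [hform, norm_mul]
  have hNn : ‖(N : ℂ)‖ = (N : ℝ) := by simp
  rw [hNn]
  have hG1 : 1 ≤ ∑ i, (|g i| : ℝ) := one_le_hsum hg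
  have hNpos : (0 : ℝ) < N := by exact_mod_cast Nat.pos_of_ne_zero hN
  have h2d : (2 : ℝ) ^ d ≤ (1 + ∑ i, (|g i| : ℝ)) ^ d := pow_le_pow_left₀ (by norm_num) (by linarith) d
  calc (N : ℝ) * ‖∑ i, (g i : ℂ) * y i‖
      < (N : ℝ) * (1 / (1 + ∑ i, (|g i| : ℝ)) ^ (ω + d)) := mul_lt_mul_of_pos_left hlt hNpos
    _ = (N : ℝ) / (1 + ∑ i, (|g i| : ℝ)) ^ d * (1 / (1 + ∑ i, (|g i| : ℝ)) ^ ω) := by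
        rw [pow_add]; field_simp
    _ ≤ 1 * (1 / (1 + ∑ i, (|g i| : ℝ)) ^ ω) := by
        refine mul_le_mul_of_nonneg_right ?_ (by positivity)
        rw [div_le_one (by positivity)]
        exact hd.trans h2d
    _ = 1 / (1 + ∑ i, (|g i| : ℝ)) ^ ω := one_mul _

/-- Clearing denominators: a tuple in `span_ℚ(x̄)` has a common integer multiple in the lattice
`span_ℤ(x̄)`. -/
theorem exists_common_nsmul_mem_span_int {n k : ℕ} (x : Fin n → ℂ) {y : Fin k → ℂ}
    (hyx : ∀ i, y i ∈ Submodule.span ℚ (Set.range x)) :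
    ∃ N : ℕ, N ≠ 0 ∧ ∀ i, (N : ℂ) * y i ∈ Submodule.span ℤ (Set.range x) := by
  classical
  choose Ny hNy hmem using fun i => exists_nsmul_mem_span_int x (hyx i)
  refine ⟨∏ i, Ny i, prod_ne_zero_iff.mpr fun i _ => hNy i, fun i => ?_⟩
  obtain ⟨c, hc⟩ := dvd_prod_of_mem Ny (mem_univ i)
  have h1 : ((∏ j, Ny j : ℕ) : ℂ) * y i = (c : ℤ) • ((Ny i : ℚ) • y i) := by
    rw [hc, Rat.smul_def, zsmul_eq_mul]; push_cast; ring
  rw [h1]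
  exact Submodule.smul_mem _ _ (hmem i)

/-- **`LinLiouville` ascends from `ℚ`-free tuples of the `ℚ`-SPAN** (`linLiouville_of_lattice` after
clearing denominators with `exists_common_nsmul_mem_span_int` and `linLiouville_smul`). -/
theorem linLiouville_of_spanQ {n k : ℕ} {x : Fin n → ℂ} {y : Fin k → ℂ}
    (hyx : ∀ i, y i ∈ Submodule.span ℚ (Set.range x)) (hy : LinearIndependent ℚ y)
    (hL : LinLiouville y) : LinLiouville x := by
  obtain ⟨N, hN, hlat⟩ := exists_common_nsmul_mem_span_int x hyx
  have hNQ : (N : ℚ) ≠ 0 := Nat.cast_ne_zero.mpr hN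
  have hli : LinearIndependent ℚ (fun i => (N : ℂ) * y i) := by
    have h := hy.units_smul (fun _ => Units.mk0 (N : ℚ) hNQ)
    convert h using 1
    funext i
    simp only [Pi.smul_apply', Units.smul_def, Units.val_mk0, Rat.smul_def, Rat.cast_natCast]
  exact linLiouville_of_lattice hlat hli (linLiouville_smul N hN hL)

/-- `CoordLiouvilleSpan` ascends from tuples of the `ℚ`-span (span monotonicity). -/
theorem coordLiouvilleSpan_of_spanQ {n k : ℕ} {x : Fin n → ℂ} {y : Fin k → ℂ}
    (hyx : ∀ i, y i ∈ Submodule.span ℚ (Set.range x)) (h : CoordLiouvilleSpan y) :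
    CoordLiouvilleSpan x := by
  obtain ⟨w, hw, hL⟩ := h
  exact ⟨w, (Submodule.span_le.mpr (Set.range_subset_iff.mpr hyx)) hw, hL⟩

/-- The route's cut predicate, negated, IS a polynomial measure of some order. -/
theorem not_linLiouville_iff_measure {n : ℕ} {z : Fin n → ℂ} :
    ¬ LinLiouville z ↔
      ∃ ω : ℕ, ∀ h : Fin n → ℤ, h ≠ 0 → 1 / (1 + ∑ i, (|h i| : ℝ)) ^ ω ≤ ‖∑ i, (h i : ℂ) * z i‖ := by
  simp only [LinLiouville, not_forall, not_exists, not_and, not_lt]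

/-- **HEREDITY OF THE POLYNOMIAL MEASURE, typed** (the route's measure has no multiplicative constant,
so the loss is absorbed in the ORDER): a measure of order `ω` at `z̄` gives a measure of order
`ω′ = (d + 1)·ω` at every `ℚ`-free lattice tuple `ȳ ⊂ span_ℤ(z̄)`, `ȳ = M z̄`, where `2^d ≥ 1 + Σᵢⱼ|Mᵢⱼ|`
(`linLiouville_of_lattice`, contraposed). -/
theorem polyMeasure_hered {n k : ℕ} {z : Fin n → ℂ} {y : Fin k → ℂ}
    (hm : ∃ ω : ℕ, ∀ h : Fin n → ℤ, h ≠ 0 → 1 / (1 + ∑ i, (|h i| : ℝ)) ^ ω ≤ ‖∑ i, (h i : ℂ) * z i‖)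
    (hy : LinearIndependent ℚ y) (hyz : ∀ j, y j ∈ Submodule.span ℤ (Set.range z)) :
    ∃ ω' : ℕ, ∀ g : Fin k → ℤ, g ≠ 0 → 1 / (1 + ∑ i, (|g i| : ℝ)) ^ ω' ≤ ‖∑ i, (g i : ℂ) * y i‖ :=
  not_linLiouville_iff_measure.mp fun hL =>
    not_linLiouville_iff_measure.mpr hm (linLiouville_of_lattice hyz hy hL)

/-- … and from `ℚ`-free tuples of the `ℚ`-span. -/
theorem polyMeasure_hered_spanQ {n k : ℕ} {z : Fin n → ℂ} {y : Fin k → ℂ}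
    (hm : ∃ ω : ℕ, ∀ h : Fin n → ℤ, h ≠ 0 → 1 / (1 + ∑ i, (|h i| : ℝ)) ^ ω ≤ ‖∑ i, (h i : ℂ) * z i‖)
    (hy : LinearIndependent ℚ y) (hyz : ∀ j, y j ∈ Submodule.span ℚ (Set.range z)) :
    ∃ ω' : ℕ, ∀ g : Fin k → ℤ, g ≠ 0 → 1 / (1 + ∑ i, (|g i| : ℝ)) ^ ω' ≤ ‖∑ i, (g i : ℂ) * y i‖ :=
  not_linLiouville_iff_measure.mp fun hL =>
    not_linLiouville_iff_measure.mpr hm (linLiouville_of_spanQ hyz hy hL)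

/-- **HEREDITY OF THE COORDINATE CLAUSE** (span monotonicity). -/
theorem coordClause_hered {n k : ℕ} {z : Fin n → ℂ} {y : Fin k → ℂ}
    (hD : ¬ ∃ w ∈ Submodule.span ℚ (Set.range z), Liouville w.re ∨ Liouville w.im)
    (hyz : ∀ j, y j ∈ Submodule.span ℚ (Set.range z)) :
    ¬ ∃ w ∈ Submodule.span ℚ (Set.range y), Liouville w.re ∨ Liouville w.im :=
  fun h => hD (coordLiouvilleSpan_of_spanQ hyz h)

/-- **Exactness: the residual equals its restriction to the core** — ONE iff.  `B₃ → B₃ᴱ` is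
restriction; `B₃ᴱ → B₃` is the pointwise Kirby trace `sb_of_eclTrace`, both Diophantine hypotheses
of B₃ descending to the `ℚ`-free `E`-tuples of the span (`coordClause_hered`, `linLiouville_of_spanQ`). -/
theorem polyDiophantineSchanuelOnE_iff : PolyDiophantineSchanuelOnE ↔ PolyDiophantineSchanuel := by
  refine ⟨fun hB n x hx hD hL => ?_, polyDiophantineSchanuelOnE_of⟩
  refine sb_of_eclTrace n x hx fun k y hyE hyx hyli => hB k y hyli hyE (coordClause_hered hD hyx) ?_
  intro hLy
  exact hL (linLiouville_of_spanQ hyx hyli hLy)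

/-- `B₃ᴱ → B₃` (the non-trivial direction of `polyDiophantineSchanuelOnE_iff`). -/
theorem polyDiophantineSchanuel_of_onE (hB : PolyDiophantineSchanuelOnE) : PolyDiophantineSchanuel :=
  polyDiophantineSchanuelOnE_iff.mp hB

end Summit.Schanuel.Schanuel.Theorems.RootDecomp1KB3KirbyTrace

end
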